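import Mathlib
import Literature.Computability.AlgebraicComplexity.PermanentBooleanSum
import Summits.ValiantsHypothesis.ValiantsHypothesis.Theorems.BarrierLeverPartitionMinorsHitByVPHiddenStatesSecondShellNestedRows
import Summits.ValiantsHypothesis.ValiantsHypothesis.Theorems.BarrierLeverPartitionMinorsHitByVPHiddenStatesSecondShellPrescribed
import Summits.ValiantsHypothesis.ValiantsHypothesis.Theorems.BarrierLeverPartitionMinorsHitByVPHiddenStatesSecondShellCrossTemplate
import Summits.ValiantsHypothesis.ValiantsHypothesis.Theorems.BarrierLeverPartitionMinorsHitByVPHiddenStatesSecondShellChainThree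

/-!
# Route BarrierLever — item `PartitionMinorsHitByVP` (stmt-ValiantsHypothesis-19717), line `hidden-states`:
# ★★ THE PARALLEL NESTED CELL — `Y₁ ⊂ Y₂`, `|Y₁| = 3`, `|Y₂| = 4` (every `t, h`)

Helper file (`--supports stmt-ValiantsHypothesis-19717`; cell valiant-natproofs, 𝒟-side door (c), registered line
`Cruxes/PartitionMinorsHitByVP/Lines/hidden_states.lean` v8; prover seat val-np-p6 gen 18).  Closes NO item; definition-free.

PARALLEL NESTED (memo HOME/val-np-p6/g17/MEMO-valnp6-g17.md §4d; planner mandate card v9i (ii)).  `Y₁ = C₁∖A₁ = {a, b, c}`,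
`Y₂ = C₂∖A₂ = {a, b, c, m}` with the extra element `m ∉ A₁`.  Orient BOTH paths in the SAME order with `m` on top of path 2:
path 1 = (a < b < c) with its two attachments `x₀, x₁` at `a`; path 2 = (a < b < c < m) with attachments `f₀, f₁` at `a` and `f`
at `b` (fully prescribed transports, `…SecondShellPrescribed.exists_equiv_prescribed`).  In the two-parameter table the start row
`C₁ = Z₁ ∪ {a,b,c}` (`Z₁ = A₁ ∩ C₁` inert) of the cross minor `D_{B − A₂ + C₁}` has THREE MOVERS forming the CHAIN `c → b → a`
with `a`-exits `x₀, x₁, f₀, f₁` and the single `b`-exit `f` — whatever the coincidences `x_i = f_j`, `x_i = f` and whichever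
exits are inert (`∈ Z₁`).  By the three-mover chain lemma (`…SecondShellChainThree.det_eq_zero_of_chain₃`) the only rows
`Z₁ ∪ T` that may be absent are pure pairs of `a`-exits, and `Z₁ ∪ {d, d'} = A₂` is impossible: choosing `f ∉ A₁` when
`A₂∖C₂ ⊄ A₁` puts `f ∈ A₂∖Z₁` outside every such pair, and when `A₂∖C₂ ⊆ A₁` every `a`-exit lies in `A₁`, forcing `A₂ ⊆ A₁`.
Hence `D_{B−A₂+C₁} ≡ 0` and the composition template (`…SecondShellCrossTemplate.exists_table_secondShell_of_cross`) serves the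
family: ★★ `exists_table_secondShell_parallelNested`.  EXACT t = 4 CENSUS (kit j321260, gen 17): this cell covers the shapes
fam 3 {0123,1234;12567,15678} (30 240 families) and fam 8/9 (15 120 each) of B₄(9) — uncovered 0.402 % → ≈ 0.29 %.

HONEST LABEL: conjecture-column cell (second shell, every `t, h`); 19717 stays OPEN; nothing on crux 14610 or VP ≠ VNP.
-/

set_option linter.dupNamespace false

namespace Summit.ValiantsHypothesis.ValiantsHypothesis.Theorems.BarrierLever.HiddenStates

open Finset

noncomputable section

namespace SecondShell

open PathTable

/-! ## ★★ The parallel nested cell -/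

/-- ★★ **SECOND SHELL, PARALLEL NESTED CLASSES, EVERY `t, h`.**  `C₁∖A₁ = {a, b, c}`, `C₂∖A₂ = {a, b, c, m}` (so `Y₁ ⊂ Y₂`,
`|Y₂| = |Y₁| + 1 = 4`) with `m ∉ A₁`: the class is served by a two-parameter path table. -/
theorem exists_table_secondShell_parallelNested (h t : ℕ) (A₁ A₂ C₁ C₂ : Finset (Fin h))
    (hA₁ : A₁.card = t) (hA₂ : A₂.card = t) (hC₁ : C₁.card = t + 1) (hC₂ : C₂.card = t + 1)
    (h₁ : ¬ A₁ ⊆ C₁) (h₂ : ¬ A₂ ⊆ C₂) (hA : A₁ ≠ A₂) (hC : C₁ ≠ C₂)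
    {ya yb yc ym : Fin h}
    (hY₁ : C₁ \ A₁ = {ya, yb, yc}) (hab : ya ≠ yb) (hac : ya ≠ yc) (hbc : yb ≠ yc)
    (hY₂ : C₂ \ A₂ = {ya, yb, yc, ym}) (hma : ym ≠ ya) (hmb : ym ≠ yb) (hmc : ym ≠ yc) (hm : ym ∉ A₁)
    {r : ℕ} (u cols : Fin r → Finset (Fin h)) (hu : Function.Injective u)
    (hU : ∀ i, ((u i).card ≤ t ∧ u i ≠ A₁ ∧ u i ≠ A₂) ∨ u i = C₁ ∨ u i = C₂)
    (hcols : ∀ J : Finset (Fin h), J.card ≤ t → ∃ kk, cols kk = J) :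
    ∃ tx : Option (Fin h) → Fin h → ℂ,
      (Matrix.of fun i kk : Fin r => ∏ a ∈ u i, (tx none a + ∑ q ∈ cols kk, tx (some q) a)).det ≠ 0 := by
  classical
  obtain ⟨k₁, j₁, j₁', hk₁, hkj₁, a1, a2, a3, a4⟩ := swap_sizes A₁ C₁ hA₁ hC₁ h₁
  obtain ⟨k₂, j₂, j₂', hk₂, hkj₂, b1, b2, b3, b4⟩ := swap_sizes A₂ C₂ hA₂ hC₂ h₂
  -- sizes: `k₁ = 2`, `k₂ = 3`
  have hY₁c : (C₁ \ A₁).card = 3 := by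
    rw [hY₁, Finset.card_insert_of_notMem (by simp [hab, hac]), Finset.card_pair hbc]
  have hY₂c : (C₂ \ A₂).card = 4 := by
    rw [hY₂, Finset.card_insert_of_notMem (by simp [hab, hac, hma.symm]),
      Finset.card_insert_of_notMem (by simp [hbc, hmb.symm]), Finset.card_pair hmc.symm]
  obtain rfl : k₁ = 2 := by omega
  obtain rfl : k₂ = 3 := by omega
  -- membership facts
  have hya₁ : ya ∈ C₁ \ A₁ := by rw [hY₁]; simp
  have hyb₁ : yb ∈ C₁ \ A₁ := by rw [hY₁]; simp
  have hyc₁ : yc ∈ C₁ \ A₁ := by rw [hY₁]; simp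
  have hya₂ : ya ∈ C₂ \ A₂ := by rw [hY₂]; simp
  have hyb₂ : yb ∈ C₂ \ A₂ := by rw [hY₂]; simp
  have hyc₂ : yc ∈ C₂ \ A₂ := by rw [hY₂]; simp
  have hym₂ : ym ∈ C₂ \ A₂ := by rw [hY₂]; simp
  obtain ⟨⟨hyaC₁, hyaA₁⟩, ⟨hybC₁, hybA₁⟩, ⟨hycC₁, hycA₁⟩⟩ :=
    And.intro (Finset.mem_sdiff.1 hya₁) (And.intro (Finset.mem_sdiff.1 hyb₁) (Finset.mem_sdiff.1 hyc₁))
  obtain ⟨⟨hyaC₂, hyaA₂⟩, ⟨hybC₂, hybA₂⟩, ⟨hycC₂, hycA₂⟩, ⟨hymC₂, hymA₂⟩⟩ :=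
    And.intro (Finset.mem_sdiff.1 hya₂) (And.intro (Finset.mem_sdiff.1 hyb₂)
      (And.intro (Finset.mem_sdiff.1 hyc₂) (Finset.mem_sdiff.1 hym₂)))
  -- the attachments of path 1
  obtain ⟨x₀, x₁, hx, hX₁⟩ := Finset.card_eq_two.1 a2
  have hx₀ : x₀ ∈ A₁ \ C₁ := by rw [hX₁]; simp
  have hx₁ : x₁ ∈ A₁ \ C₁ := by rw [hX₁]; simp
  -- the attachments of path 2, the level-1 attachment `f` outside `A₁` whenever possible
  obtain ⟨f₀, f₁, f, hf₀₁, hf₀, hf₁, hX₂, hfA⟩ : ∃ f₀ f₁ f : Fin h, f₀ ≠ f₁ ∧ f₀ ≠ f ∧ f₁ ≠ f ∧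
      A₂ \ C₂ = {f₀, f₁, f} ∧ (f ∈ A₁ → A₂ \ C₂ ⊆ A₁) := by
    by_cases hsub : A₂ \ C₂ ⊆ A₁
    · obtain ⟨g₀, g₁, g₂, h01, h02, h12, hX⟩ := Finset.card_eq_three.1 b2
      exact ⟨g₀, g₁, g₂, h01, h02, h12, hX, fun _ => hsub⟩
    · obtain ⟨f, hfX, hfA⟩ := Finset.not_subset.1 hsub
      have hc : ((A₂ \ C₂).erase f).card = 2 := by rw [Finset.card_erase_of_mem hfX, b2]
      obtain ⟨g₀, g₁, h01, hX⟩ := Finset.card_eq_two.1 hc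
      have hg₀ : g₀ ∈ (A₂ \ C₂).erase f := by rw [hX]; simp
      have hg₁ : g₁ ∈ (A₂ \ C₂).erase f := by rw [hX]; simp
      refine ⟨g₀, g₁, f, h01, (Finset.mem_erase.1 hg₀).1, (Finset.mem_erase.1 hg₁).1, ?_, fun h' => absurd h' hfA⟩
      rw [← Finset.insert_erase hfX, hX]
      ext q; simp only [Finset.mem_insert, Finset.mem_singleton]; tauto
  have hf₀X : f₀ ∈ A₂ \ C₂ := by rw [hX₂]; simp
  have hf₁X : f₁ ∈ A₂ \ C₂ := by rw [hX₂]; simp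
  have hfX : f ∈ A₂ \ C₂ := by rw [hX₂]; simp
  -- fully prescribed transports: path 1 = (ya < yb < yc), x₀, x₁ at ya; path 2 = (ya < yb < yc < ym), f₀, f₁ at ya, f at yb
  have hinjY₁ : Function.Injective ![ya, yb, yc] := injective_vec3 hab hac hbc
  have hinjX₁ : Function.Injective ![x₀, x₁] := injective_vec2 hx
  have hinjY₂ : Function.Injective ![ya, yb, yc, ym] := Literature.Computability.AlgebraicComplexity.injective_vec4 hab hac hma.symm hbc hmb.symm hmc.symm
  have hinjX₂ : Function.Injective ![f₀, f₁, f] := injective_vec3 hf₀₁ hf₀ hf₁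
  have hmemY₁ : ∀ p, ![ya, yb, yc] p ∈ C₁ \ A₁ := by
    intro p; fin_cases p
    · exact hya₁
    · exact hyb₁
    · exact hyc₁
  have hmemX₁ : ∀ i, ![x₀, x₁] i ∈ A₁ \ C₁ := by
    intro i; fin_cases i
    · exact hx₀
    · exact hx₁
  have hmemY₂ : ∀ p, ![ya, yb, yc, ym] p ∈ C₂ \ A₂ := by
    intro p; fin_cases p
    · exact hya₂
    · exact hyb₂
    · exact hyc₂
    · exact hym₂
  have hmemX₂ : ∀ i, ![f₀, f₁, f] i ∈ A₂ \ C₂ := by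
    intro i; fin_cases i
    · exact hf₀X
    · exact hf₁X
    · exact hfX
  obtain ⟨e₁, m1, m2, m3, m4, hpy₁, hpx₁⟩ := exists_equiv_prescribed A₁ C₁ a1 a2 a3 a4 _ hinjY₁ hmemY₁ _ hinjX₁ hmemX₁
  obtain ⟨e₂, n1, n2, n3, n4, hpy₂, hpx₂⟩ := exists_equiv_prescribed A₂ C₂ b1 b2 b3 b4 _ hinjY₂ hmemY₂ _ hinjX₂ hmemX₂
  have he₁a : e₁ (Sum.inl (Sum.inl 0)) = ya := by rw [hpy₁]; rfl
  have he₁b : e₁ (Sum.inl (Sum.inl 1)) = yb := by rw [hpy₁]; rfl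
  have he₁c : e₁ (Sum.inl (Sum.inl 2)) = yc := by rw [hpy₁]; rfl
  have he₁x₀ : e₁ (Sum.inl (Sum.inr 0)) = x₀ := by rw [hpx₁]; rfl
  have he₁x₁ : e₁ (Sum.inl (Sum.inr 1)) = x₁ := by rw [hpx₁]; rfl
  have he₂a : e₂ (Sum.inl (Sum.inl 0)) = ya := by rw [hpy₂]; rfl
  have he₂b : e₂ (Sum.inl (Sum.inl 1)) = yb := by rw [hpy₂]; rfl
  have he₂c : e₂ (Sum.inl (Sum.inl 2)) = yc := by rw [hpy₂]; rfl
  have he₂f₀ : e₂ (Sum.inl (Sum.inr 0)) = f₀ := by rw [hpx₂]; rfl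
  have he₂f₁ : e₂ (Sum.inl (Sum.inr 1)) = f₁ := by rw [hpx₂]; rfl
  have he₂f : e₂ (Sum.inl (Sum.inr 2)) = f := by rw [hpx₂]; rfl
  -- ★ the composition template: it remains to kill the cross minor `D_{B − A₂ + C₁}` in key form
  refine exists_table_secondShell_of_cross h t A₁ A₂ C₁ C₂ hA₁ hA₂ hC₁ hC₂ hA hC hk₁ hkj₁ hk₂ hkj₂ e₁ m1 m2 m3 m4
    e₂ n1 n2 n3 n4 u cols hu hU hcols (Or.inr ?_)
  intro rows i₀ hrow₀ key hcolcard ε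
  -- table facts: zeros along the chain, unit rows of the attachments
  have v₁ab : swapTable' e₁ ya yb = 0 := by rw [← he₁a, ← he₁b, swapTable'_path_path]; simp
  have v₁ac : swapTable' e₁ ya yc = 0 := by rw [← he₁a, ← he₁c, swapTable'_path_path]; simp
  have v₁bc : swapTable' e₁ yb yc = 0 := by rw [← he₁b, ← he₁c, swapTable'_path_path]; simp
  have v₁ca : swapTable' e₁ yc ya = 0 := by rw [← he₁c, ← he₁a, swapTable'_path_path]; simp
  have v₂ab : swapTable' e₂ ya yb = 0 := by rw [← he₂a, ← he₂b, swapTable'_path_path]; simp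
  have v₂ac : swapTable' e₂ ya yc = 0 := by rw [← he₂a, ← he₂c, swapTable'_path_path]; simp
  have v₂bc : swapTable' e₂ yb yc = 0 := by rw [← he₂b, ← he₂c, swapTable'_path_path]; simp
  have v₂ca : swapTable' e₂ yc ya = 0 := by rw [← he₂c, ← he₂a, swapTable'_path_path]; simp
  have hunit : ∀ d, d ∈ A₁ \ C₁ ∨ d ∈ A₂ \ C₂ → ∀ q, swapTable' e₁ d q = (if q = d then 1 else 0) ∧
      swapTable' e₂ d q = (if q = d then 1 else 0) := by
    intro d hd q
    have hd₁ : d ∉ C₁ \ A₁ := by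
      rcases hd with hd | hd
      · exact fun h' => (Finset.mem_sdiff.1 h').2 (Finset.mem_sdiff.1 hd).1
      · intro h'
        have hdC₁ := (Finset.mem_sdiff.1 h').1
        rw [hY₁] at h'
        simp only [Finset.mem_insert, Finset.mem_singleton] at h'
        rcases h' with rfl | rfl | rfl
        · exact (Finset.mem_sdiff.1 hd).2 hyaC₂
        · exact (Finset.mem_sdiff.1 hd).2 hybC₂
        · exact (Finset.mem_sdiff.1 hd).2 hycC₂
    have hd₂ : d ∉ C₂ \ A₂ := by
      rcases hd with hd | hd
      · intro h'
        have hdA₁ := (Finset.mem_sdiff.1 hd).1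
        rw [hY₂] at h'
        simp only [Finset.mem_insert, Finset.mem_singleton] at h'
        rcases h' with rfl | rfl | rfl | rfl
        · exact hyaA₁ hdA₁
        · exact hybA₁ hdA₁
        · exact hycA₁ hdA₁
        · exact hm hdA₁
      · exact fun h' => (Finset.mem_sdiff.1 h').2 (Finset.mem_sdiff.1 hd).1
    exact ⟨row_unit A₁ C₁ e₁ m1 hd₁ q, row_unit A₂ C₂ e₂ n1 hd₂ q⟩
  -- which coordinates the movers read
  have hsrc₁ : ∀ (p : Fin (2 + 1)) (d : Fin h), swapTable' e₁ (e₁ (Sum.inl (Sum.inl p))) d ≠ 0 →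
      d ≠ e₁ (Sum.inl (Sum.inl p)) → (∃ p' : Fin (2 + 1), (p' : ℕ) + 1 = p ∧ d = e₁ (Sum.inl (Sum.inl p'))) ∨
        (lvlX 2 0 = p ∧ d = x₀) ∨ (lvlX 2 1 = p ∧ d = x₁) := by
    intro p d hd hne'
    rcases swapTable'_path_row_ne_zero e₁ p hd hne' with h' | ⟨i, hi, rfl⟩
    · exact Or.inl h'
    · right
      fin_cases i
      · exact Or.inl ⟨hi, he₁x₀⟩
      · exact Or.inr ⟨hi, he₁x₁⟩
  have hsrc₂ : ∀ (p : Fin (3 + 1)) (d : Fin h), swapTable' e₂ (e₂ (Sum.inl (Sum.inl p))) d ≠ 0 →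
      d ≠ e₂ (Sum.inl (Sum.inl p)) → (∃ p' : Fin (3 + 1), (p' : ℕ) + 1 = p ∧ d = e₂ (Sum.inl (Sum.inl p'))) ∨
        (lvlX 3 0 = p ∧ d = f₀) ∨ (lvlX 3 1 = p ∧ d = f₁) ∨ (lvlX 3 2 = p ∧ d = f) := by
    intro p d hd hne'
    rcases swapTable'_path_row_ne_zero e₂ p hd hne' with h' | ⟨i, hi, rfl⟩
    · exact Or.inl h'
    · right
      fin_cases i
      · exact Or.inl ⟨hi, he₂f₀⟩
      · exact Or.inr (Or.inl ⟨hi, he₂f₁⟩)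
      · exact Or.inr (Or.inr ⟨hi, he₂f⟩)
  -- ★ the cancellation: the cross minor `D_{B − A₂ + C₁}` vanishes for every parameter (three-mover chain lemma)
  set w : Fin h → Fin h → ℂ := tab2 (fun a q => swapTable' e₁ a q - if q = a then 1 else 0)
      (fun a q => swapTable' e₂ a q - if q = a then 1 else 0) ε with hw
  have hwdef : ∀ y q, w y q = (if q = y then 1 else 0) + ε 0 * (swapTable' e₁ y q - if q = y then 1 else 0)
      + ε 1 * (swapTable' e₂ y q - if q = y then 1 else 0) := fun y q => rfl
  -- reading off-diagonal: one of the two path tables reads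
  have hoff : ∀ y d, d ≠ y → w y d ≠ 0 → swapTable' e₁ y d ≠ 0 ∨ swapTable' e₂ y d ≠ 0 := by
    intro y d hdy hw0
    by_contra hcon
    push Not at hcon
    apply hw0
    rw [hwdef, hcon.1, hcon.2, if_neg hdy]; ring
  -- the bottom `ya` reads only `x₀, x₁, f₀, f₁`
  have hreada : ∀ d, d ≠ ya → w ya d ≠ 0 → d = x₀ ∨ d = x₁ ∨ d = f₀ ∨ d = f₁ := by
    intro d hd hw0
    rcases hoff ya d hd hw0 with h' | h'
    · rw [← he₁a] at h' hd
      rcases hsrc₁ 0 d h' hd with ⟨p', hp', -⟩ | ⟨-, rfl⟩ | ⟨-, rfl⟩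
      · exfalso; simp at hp'
      · exact Or.inl rfl
      · exact Or.inr (Or.inl rfl)
    · rw [← he₂a] at h' hd
      rcases hsrc₂ 0 d h' hd with ⟨p', hp', -⟩ | ⟨-, rfl⟩ | ⟨-, rfl⟩ | ⟨hl, -⟩
      · exfalso; simp at hp'
      · exact Or.inr (Or.inr (Or.inl rfl))
      · exact Or.inr (Or.inr (Or.inr rfl))
      · exfalso; simp [lvlX] at hl
  -- `yb` reads only `ya` and `f`; `yc` reads only `yb`
  have hreadb : ∀ d, d ≠ yb → w yb d ≠ 0 → d = ya ∨ d = f := by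
    intro d hd hw0
    rcases hoff yb d hd hw0 with h' | h'
    · rw [← he₁b] at h' hd
      rcases hsrc₁ 1 d h' hd with ⟨p', hp', rfl⟩ | ⟨hl, -⟩ | ⟨hl, -⟩
      · left
        fin_cases p' <;> first | exact he₁a | (exfalso; simp at hp')
      · exfalso; simp [lvlX] at hl
      · exfalso; simp [lvlX] at hl
    · rw [← he₂b] at h' hd
      rcases hsrc₂ 1 d h' hd with ⟨p', hp', rfl⟩ | ⟨hl, -⟩ | ⟨hl, -⟩ | ⟨-, rfl⟩
      · left
        fin_cases p' <;> first | exact he₂a | (exfalso; simp at hp')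
      · exfalso; simp [lvlX] at hl
      · exfalso; simp [lvlX] at hl
      · exact Or.inr rfl
  have hreadc : ∀ d, d ≠ yc → w yc d ≠ 0 → d = yb := by
    intro d hd hw0
    rcases hoff yc d hd hw0 with h' | h'
    · rw [← he₁c] at h' hd
      rcases hsrc₁ 2 d h' hd with ⟨p', hp', rfl⟩ | ⟨hl, -⟩ | ⟨hl, -⟩
      · fin_cases p' <;> first | exact he₁b | (exfalso; simp at hp')
      · exfalso; simp [lvlX] at hl
      · exfalso; simp [lvlX] at hl
    · rw [← he₂c] at h' hd
      rcases hsrc₂ 2 d h' hd with ⟨p', hp', rfl⟩ | ⟨hl, -⟩ | ⟨hl, -⟩ | ⟨hl, -⟩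
      · fin_cases p' <;> first | exact he₂b | (exfalso; simp at hp')
      · exfalso; simp [lvlX] at hl
      · exfalso; simp [lvlX] at hl
      · exfalso; simp [lvlX] at hl
  have hZ₁c : (A₁ ∩ C₁).card + 2 = t := by rw [a3]; omega
  refine det_eq_zero_of_chain₃ w rows cols i₀ (A₁ ∩ C₁) hab hac hbc
    (fun h' => hyaA₁ (Finset.mem_inter.1 h').1) (fun h' => hybA₁ (Finset.mem_inter.1 h').1)
    (fun h' => hycA₁ (Finset.mem_inter.1 h').1) ?_ ?_ ?_ ?_ ?_ ?_ ?_ ?_ ?_ ?_ ?_ ?_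
  · rw [hrow₀]; exact eq_insert₃_inter hY₁
  · -- unit rows on `Z₁ = A₁ ∩ C₁`
    intro z hz q
    obtain ⟨hzA, hzC⟩ := Finset.mem_inter.1 hz
    have hz₁ : z ∉ C₁ \ A₁ := fun h' => (Finset.mem_sdiff.1 h').2 hzA
    have hz₂ : z ∉ C₂ \ A₂ := by
      intro h'
      rw [hY₂] at h'
      simp only [Finset.mem_insert, Finset.mem_singleton] at h'
      rcases h' with rfl | rfl | rfl | rfl
      · exact hyaA₁ hzA
      · exact hybA₁ hzA
      · exact hycA₁ hzA
      · exact hm hzA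
    rw [hwdef, row_unit A₁ C₁ e₁ m1 hz₁ q, row_unit A₂ C₂ e₂ n1 hz₂ q]; ring
  · rw [hwdef, swapTable'_self, swapTable'_self, if_pos rfl]; ring
  · rw [hwdef, v₁ab, v₂ab, if_neg hab.symm]; ring
  · rw [hwdef, v₁ac, v₂ac, if_neg hac.symm]; ring
  · rw [hwdef, swapTable'_self, swapTable'_self, if_pos rfl]; ring
  · rw [hwdef, v₁bc, v₂bc, if_neg hbc.symm]; ring
  · rw [hwdef, swapTable'_self, swapTable'_self, if_pos rfl]; ring
  · rw [hwdef, v₁ca, v₂ca, if_neg hac]; ring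
  · -- read exits are attachments, hence unit rows
    intro d _ hda hdb hdc hread q
    have hd : d ∈ A₁ \ C₁ ∨ d ∈ A₂ \ C₂ := by
      rcases hread with h' | h' | h'
      · rcases hreada d hda h' with rfl | rfl | rfl | rfl
        · exact Or.inl hx₀
        · exact Or.inl hx₁
        · exact Or.inr hf₀X
        · exact Or.inr hf₁X
      · rcases hreadb d hdb h' with rfl | rfl
        · exact absurd rfl hda
        · exact Or.inr hfX
      · exact absurd (hreadc d hdc h') hdb
    rw [hwdef, (hunit d hd q).1, (hunit d hd q).2]; ring
  · intro kk; rw [hZ₁c]; exact hcolcard kk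
  · -- ★ every needed row `Z₁ ∪ T` is present: it is small, and it is not `A₂`
    intro T hTZ hTc hTread hTpair
    have hcard : (T ∪ A₁ ∩ C₁).card ≤ t := by rw [Finset.card_union_of_disjoint hTZ]; omega
    refine key _ hcard fun hEq => ?_
    -- `T ∪ Z₁ = A₂`: then `T` is a pure pair of `ya`-exits, all inside `A₁`, forcing `A₂ ⊆ A₁`
    have hT2 : T.card = 2 := by
      have h1 := Finset.card_union_of_disjoint hTZ; rw [hEq, hA₂] at h1; omega
    have hmovT : ∀ y, y ∉ A₂ → y ∉ T := fun y hy hyT => hy (by rw [← hEq]; exact Finset.mem_union_left _ hyT)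
    have haT := hmovT ya hyaA₂
    have hbT := hmovT yb hybA₂
    have hcT := hmovT yc hycA₂
    have hbot : ∀ d ∈ T, d = x₀ ∨ d = x₁ ∨ d = f₀ ∨ d = f₁ := fun d hd =>
      hreada d (fun h' => haT (h' ▸ hd)) (hTpair hT2 haT hbT hcT d hd)
    -- `f ∈ A₁`
    have hfA₁ : f ∈ A₁ := by
      have hfA₂ : f ∈ A₂ := (Finset.mem_sdiff.1 hfX).1
      rw [← hEq, Finset.mem_union] at hfA₂
      rcases hfA₂ with hfT | hfZ
      · rcases hbot f hfT with h' | h' | h' | h'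
        · rw [h']; exact (Finset.mem_sdiff.1 hx₀).1
        · rw [h']; exact (Finset.mem_sdiff.1 hx₁).1
        · exact absurd h'.symm hf₀
        · exact absurd h'.symm hf₁
      · exact (Finset.mem_inter.1 hfZ).1
    have hXA := hfA hfA₁
    have hTA₁ : T ⊆ A₁ := by
      intro d hd
      rcases hbot d hd with rfl | rfl | rfl | rfl
      · exact (Finset.mem_sdiff.1 hx₀).1
      · exact (Finset.mem_sdiff.1 hx₁).1
      · exact hXA hf₀X
      · exact hXA hf₁X
    have hA₂A₁ : A₂ ⊆ A₁ := by
      rw [← hEq]; exact Finset.union_subset hTA₁ Finset.inter_subset_left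
    exact hA (Finset.eq_of_subset_of_card_le hA₂A₁ (by rw [hA₁, hA₂])).symm

end SecondShell

end

end Summit.ValiantsHypothesis.ValiantsHypothesis.Theorems.BarrierLever.HiddenStates
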